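import Summits.Schanuel.Schanuel.Theses.DiophantineDichotomy

/-!
# Two shape facts for the crux `ApproximationProperty` (stmt-Schanuel-6117): `1 ≤ t` is
load-bearing, and the constant cannot be uniform in `θ`
(negative lemmas, route DiophantineDichotomy)

The crux `Summit.Schanuel.Schanuel.Theses.DiophantineDichotomy.ApproximationProperty` reads
`∀ ι θ t, 1 ≤ t → trdeg ℚ(θ) ≤ t → ∃ c ≥ 1, ∀ Y ≥ Δ ≥ c, ∃ γ d H, …, d ≤ (cΔ)ᵗ,
log H ≤ cYΔ^{t-1}, ‖γ − θ‖ ≤ exp(−(log H·Δ + d·Y)/c)` (pointwise affine form of Philippon's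
approximation property, Nesterenko–Philippon LNM 1752 Ch. 4 §4). Two kernel-checked facts about
its SHAPE:

* `false_without_pos_t` — with the side condition `1 ≤ t` dropped the statement is FALSE: at
  `t = 0` the degree budget `(cΔ)⁰ = 1` forces rational approximants, absurd at the algebraic
  non-real point `θ = i` (`ι = Fin 1`, `trdeg ℚ(i) = 0`). Any proof must use `1 ≤ t`.
* `false_with_uniform_constant` — the strengthening with ONE constant `c` for all points
  (`∃ c, ∀ ι θ t, …`, as in Philippon's projective AP2 where `c'(n)` depends on `n` only) is FALSE
  in the crux's affine / naive-height / sup-norm normalisation: `θ = N ∈ ℕ`, `N ≥ e^{c²} + 2`,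
  has no certified approximant at the first scale `Δ = Y = c`, by Cauchy's root bound
  `‖γ‖ < H + 1 ≤ e^{c²} + 1`. So `c = c(θ) ≳ log⁺ maxᵢ‖θᵢ‖` is forced.

Everything is proved; no definitions, no named facts.
-/

noncomputable section

-- `Summit.Schanuel.Schanuel.…` is the mandated summit/sub-problem namespace (single-conjunct summit):
set_option linter.dupNamespace false

namespace Summit.Schanuel.Schanuel.Theorems.ApproximationPropertyShape

open Polynomial

/-- A constant tuple with an integral value generates an algebraic extension: `trdeg = 0 ≤ t`.
(The crux's `trdeg` carries `DivisionRing.toRatAlgebra`; Mathlib's lemma the subfield's own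
`ℚ`-algebra structure — they agree by `algebra_rat_subsingleton`.) -/
theorem trdeg_adjoin_range_const_le {x : ℂ} (hx : IsIntegral ℚ x) (n t : ℕ) :
    Algebra.trdeg ℚ ↥(IntermediateField.adjoin ℚ (Set.range fun _ : Fin n => x)) ≤
      (t : Cardinal) := by
  have hA := IntermediateField.isAlgebraic_adjoin (K := ℚ) (S := Set.range fun _ : Fin n => x)
    (by rintro _ ⟨_, rfl⟩; exact hx)
  have h0 : Algebra.trdeg ℚ ↥(IntermediateField.adjoin ℚ (Set.range fun _ : Fin n => x)) = 0 := by
    convert @trdeg_eq_zero ℚ _ _ _ _ hA using 2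
    exact Subsingleton.elim _ _
  rw [h0]
  exact zero_le

/-- From a certifying polynomial of degree `≤ 1`, the approximant is a quotient of integers. -/
theorem eq_intCast_div_of_natDegree_le_one {z : ℂ} {P : ℤ[X]} (hP0 : P ≠ 0)
    (hdeg : P.natDegree ≤ 1) (hz : aeval z P = 0) :
    P.coeff 1 ≠ 0 ∧ z = -((P.coeff 0 : ℤ) : ℂ) / ((P.coeff 1 : ℤ) : ℂ) := by
  have hP := eq_X_add_C_of_natDegree_le_one hdeg
  rw [hP, map_add, map_mul, aeval_C, aeval_X, aeval_C] at hz
  simp only [algebraMap_int_eq, eq_intCast] at hz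
  have h1 : P.coeff 1 ≠ 0 := by
    intro h1
    have h0 : P.coeff 0 = 0 := by
      rw [h1] at hz
      exact_mod_cast (by simpa using hz : ((P.coeff 0 : ℤ) : ℂ) = 0)
    exact hP0 (by rw [hP, h1, h0]; simp)
  refine ⟨h1, ?_⟩
  have h1' : ((P.coeff 1 : ℤ) : ℂ) ≠ 0 := by exact_mod_cast h1
  field_simp
  linear_combination hz

/-- **`1 ≤ t` is load-bearing.** The crux with the side condition `1 ≤ t` dropped is false:
witness `ι = Fin 1`, `θ = i`, `t = 0`, scale `Δ = Y = c`; a certified `γ 0` is `-b/a ∈ ℚ ⊂ ℝ`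
(degree budget `(c·c)⁰ = 1`), so `‖γ − θ‖ ≥ |Im(γ 0 − i)| = 1 > exp(−(log H + d))`. [folklore] -/
theorem false_without_pos_t :
    ¬ (∀ (ι : Type) [Fintype ι] (θ : ι → ℂ) (t : ℕ),
        Algebra.trdeg ℚ ↥(IntermediateField.adjoin ℚ (Set.range θ)) ≤ (t : Cardinal) →
        ∃ c : ℝ, 1 ≤ c ∧ ∀ Δ Y : ℝ, c ≤ Δ → Δ ≤ Y → ∃ (γ : ι → ℂ) (d H : ℕ),
          Module.finrank ℚ ↥(IntermediateField.adjoin ℚ (Set.range γ)) ≤ d ∧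
          (∀ i, ∃ P : Polynomial ℤ, P ≠ 0 ∧ P.natDegree ≤ d ∧ (∀ k, |P.coeff k| ≤ (H : ℤ)) ∧
            Polynomial.aeval (γ i) P = 0) ∧
          (d : ℝ) ≤ (c * Δ) ^ t ∧ Real.log H ≤ c * Y * Δ ^ (t - 1) ∧
          ‖γ - θ‖ ≤ Real.exp (-((Real.log H * Δ + d * Y) / c))) := by
  intro h
  have hI : IsIntegral ℚ Complex.I :=
    ⟨X ^ 2 + C 1, monic_X_pow_add_C 1 two_ne_zero, by simp [eval₂_add, eval₂_X_pow, Complex.I_sq]⟩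
  obtain ⟨c, hc, hall⟩ :=
    h (Fin 1) (fun _ => Complex.I) 0 (trdeg_adjoin_range_const_le hI 1 0)
  obtain ⟨γ, d, H, -, h2, h3, -, h5⟩ := hall c c le_rfl le_rfl
  obtain ⟨P, hP0, hPdeg, -, hPγ⟩ := h2 0
  have hd1 : d ≤ 1 := by exact_mod_cast (h3.trans_eq (pow_zero _))
  obtain ⟨h1, hz⟩ := eq_intCast_div_of_natDegree_le_one hP0 (hPdeg.trans hd1) hPγ
  have him : (γ 0).im = 0 := by
    rw [hz, Complex.div_im]
    simp
  have hfar : (1 : ℝ) ≤ ‖γ - fun _ => Complex.I‖ := by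
    have hle := norm_le_pi_norm (γ - fun _ : Fin 1 => Complex.I) 0
    refine le_trans ?_ hle
    have := Complex.abs_im_le_norm (γ 0 - Complex.I)
    simp only [Pi.sub_apply] at this ⊢
    simpa [him] using this
  have hd : 1 ≤ d := by
    by_contra hd
    exact h1 (coeff_eq_zero_of_natDegree_lt (by omega))
  have hH : 0 ≤ Real.log H := Real.log_natCast_nonneg H
  have hc0 : 0 < c := by linarith
  have hneg : -((Real.log H * c + d * c) / c) < 0 := by
    have : (Real.log H * c + d * c) / c = Real.log H + d := by field_simp
    rw [this]
    have : (1 : ℝ) ≤ d := by exact_mod_cast hd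
    linarith
  have := hfar.trans h5
  rw [← Real.exp_zero] at this
  exact absurd (Real.exp_le_exp.mp this) (not_le.mpr hneg)

/-- Cauchy's bound for a certifying polynomial: a root of a non-zero integer polynomial whose
coefficients are bounded by `H` has modulus `< H + 1`. [folklore] -/
theorem norm_lt_of_certificate {z : ℂ} {P : ℤ[X]} {H : ℕ} (hP0 : P ≠ 0)
    (hco : ∀ k, |P.coeff k| ≤ (H : ℤ)) (hz : aeval z P = 0) : ‖z‖ < H + 1 := by
  set Q : ℂ[X] := P.map (Int.castRingHom ℂ) with hQ
  have hQ0 : Q ≠ 0 := (Polynomial.map_ne_zero_iff Int.cast_injective).mpr hP0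
  have hroot : Q.IsRoot z := by
    rw [IsRoot, hQ, eval_map, ← algebraMap_int_eq, ← aeval_def, hz]
  have hcb := hroot.norm_lt_cauchyBound hQ0
  have hlead : (1 : NNReal) ≤ ‖Q.leadingCoeff‖₊ := by
    rw [hQ, leadingCoeff_map_of_injective Int.cast_injective, Int.coe_castRingHom]
    rw [← NNReal.coe_le_coe, coe_nnnorm, Complex.norm_intCast, NNReal.coe_one]
    exact_mod_cast Int.one_le_abs (leadingCoeff_ne_zero.mpr hP0)
  have hsup : (Finset.range Q.natDegree).sup (fun i => ‖Q.coeff i‖₊) ≤ (H : NNReal) := by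
    refine Finset.sup_le fun i _ => ?_
    rw [hQ, coeff_map, Int.coe_castRingHom, ← NNReal.coe_le_coe, coe_nnnorm, Complex.norm_intCast,
      NNReal.coe_natCast]
    exact_mod_cast hco i
  have hcble : cauchyBound Q ≤ (H : NNReal) + 1 := by
    unfold cauchyBound
    gcongr
    rw [div_le_iff₀ (lt_of_lt_of_le zero_lt_one hlead)]
    exact hsup.trans (le_mul_of_one_le_right (by simp) hlead)
  have := hcb.trans_le hcble
  rw [← NNReal.coe_lt_coe] at this
  simpa using this

/-- **The constant cannot be uniform in `θ`.** The crux with `∃ c` moved in front of `∀ ι θ t`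
is false: witness `ι = Fin 1`, `t = 1`, `θ = N ∈ ℕ` with `N ≥ e^{c²} + 2` (`trdeg = 0 ≤ 1`), scale
`Δ = Y = c`: a certified `γ 0` has `‖γ 0‖ < H + 1 ≤ e^{c²} + 1` (Cauchy, `log H ≤ c·c`) but must
be within `exp(−(log H + d)) ≤ 1` of `N`. [folklore] -/
theorem false_with_uniform_constant :
    ¬ (∃ c : ℝ, 1 ≤ c ∧ ∀ (ι : Type) [Fintype ι] (θ : ι → ℂ) (t : ℕ), 1 ≤ t →
        Algebra.trdeg ℚ ↥(IntermediateField.adjoin ℚ (Set.range θ)) ≤ (t : Cardinal) →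
        ∀ Δ Y : ℝ, c ≤ Δ → Δ ≤ Y → ∃ (γ : ι → ℂ) (d H : ℕ),
          Module.finrank ℚ ↥(IntermediateField.adjoin ℚ (Set.range γ)) ≤ d ∧
          (∀ i, ∃ P : Polynomial ℤ, P ≠ 0 ∧ P.natDegree ≤ d ∧ (∀ k, |P.coeff k| ≤ (H : ℤ)) ∧
            Polynomial.aeval (γ i) P = 0) ∧
          (d : ℝ) ≤ (c * Δ) ^ t ∧ Real.log H ≤ c * Y * Δ ^ (t - 1) ∧
          ‖γ - θ‖ ≤ Real.exp (-((Real.log H * Δ + d * Y) / c))) := by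
  rintro ⟨c, hc, h⟩
  obtain ⟨N, hN⟩ := exists_nat_ge (Real.exp (c * c) + 2)
  have hint : IsIntegral ℚ ((N : ℕ) : ℂ) := by
    simpa using isIntegral_algebraMap (R := ℚ) (A := ℂ) (x := (N : ℚ))
  obtain ⟨γ, d, H, -, h2, -, h4, h5⟩ := h (Fin 1) (fun _ => (N : ℂ)) 1 le_rfl
    (trdeg_adjoin_range_const_le hint 1 1) c c le_rfl le_rfl
  obtain ⟨P, hP0, -, hPco, hPγ⟩ := h2 0
  have hsmall : ‖γ 0‖ < H + 1 := norm_lt_of_certificate hP0 hPco hPγ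
  have hH : (H : ℝ) ≤ Real.exp (c * c) := by
    rcases Nat.eq_zero_or_pos H with h0 | hpos
    · rw [h0]; simpa using (Real.exp_pos _).le
    · have hlog : Real.log H ≤ c * c := by simpa using h4
      calc (H : ℝ) = Real.exp (Real.log H) := (Real.exp_log (by exact_mod_cast hpos)).symm
        _ ≤ Real.exp (c * c) := Real.exp_le_exp.mpr hlog
  have hclose : ‖γ 0 - (N : ℂ)‖ ≤ 1 := by
    have hle := norm_le_pi_norm (γ - fun _ : Fin 1 => (N : ℂ)) 0
    simp only [Pi.sub_apply] at hle
    refine hle.trans (h5.trans ?_)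
    rw [Real.exp_le_one_iff, neg_nonpos]
    have hc0 : 0 < c := by linarith
    have hlog : 0 ≤ Real.log H := Real.log_natCast_nonneg H
    positivity
  have hNle : (N : ℝ) ≤ ‖γ 0‖ + 1 := by
    have := norm_sub_norm_le (N : ℂ) (γ 0)
    rw [Complex.norm_natCast, norm_sub_rev] at this
    linarith
  linarith

end Summit.Schanuel.Schanuel.Theorems.ApproximationPropertyShape

end
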